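import Mathlib.Data.Nat.Bitwise

/-!
# ω-census, icoset class negatives: the kernel H-STAGE SEARCH ENGINE (recursor form)

HONEST FRAMING (pub-omega census; verbatim): lottery ticket; floor = certified bounds/negative ranges.
Census STRUCTURE bookkeeping (question Q7; the involution-coset class of `(2,2,2)^K` families, `STPP222IcosetCriterion.lean`),
nothing about `ω`.  This file is pure machinery (no group, no theorem about STPP families): the search that the kernel runs
in the class-negative files; its soundness is `STPP222IcosetHSearchSound.lean`.

WHAT IS SEARCHED.  By the icoset criterion at 2-rank three (`Icoset.Data.isSTPP_iff_of_span_eq_top`) an icoset `(2,2,2)^K`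
STPP family in `𝔽₂³ × H` yields, after the normalisations `a ≡ 0`, `b₀ = c₀ = 0`, relabelling of the triples so that the codes
of `b` increase (soundness file), functions `b c : [K] → H` with `c` and `b − c` injective, and a labelling of the `3K` PLANE SLOTS
`AB_t, BC_t, AC_t` (slot `3t + s`) by the planes `⟨sA_t,sB_t⟩, ⟨sB_t,sC_t⟩, ⟨sA_t,sC_t⟩` such that (i) the three slots of a triple
carry three different planes and (ii) every ZERO TRIPLE — pairwise distinct `(i,j,k)` with `b_j + c_k = b_i + c_j`, i.e.
`h(i,j,k) = 0` — has `AB_i, BC_j, AC_k` labelled by the same plane (a rescued triple's six slots lie in one plane).  The engine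
refutes the existence of such `(b, c, labelling)`: depth-first over `(b_m, c_m)` (codes `x > code b_{m−1}`, `y` outside the
forbidden mask of the injectivity conditions), merging slot labels along the new zero triples and pruning as soon as two slots of
one triple carry the same label; `true` = every branch pruned.

KERNEL FORM (as in `STPP222CubeEngine.lean`): group elements are `ℕ`-codes with a code arithmetic `CArith` (`addC`, `subC`, number
of codes); all loops are recursor applications (`Nat.rec` / `List.rec`, no compiled recursion), all arithmetic is the kernel-
accelerated `Nat` one, and every piece of state (the code lists of `b`, `c` and the label list) is FORCED to a literal before it
is shared (`forceL`, `forceN`, continuation-passing `applyMerges`) — without forcing the lazily substituted state is re-evaluated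
exponentially often (measured: 20 ms/node unforced vs ≈ 3.6 ms/node here, seat log 2026-08-27).
References: H. Cohn, R. Kleinberg, B. Szegedy, C. Umans, FOCS 2005 (arXiv:math/0511460), Def. 5.1 (the STPP behind the class);
cell note `HOME/pub-omega-eng2-g27/icoset/ICOSET-NOTE.md` (the engine-grade version of this search, `icoset3.py`).
Seat pub-omega-kernel-l4 (gen 19), 2026-08-27.
-/

namespace Summit.MatrixMultiplication.OmegaCensus

namespace IcosetH

/-! ## Forcing and list primitives (recursor form) -/

/-- Deep-force a list of naturals (spine and entries), then continue with the literal list. -/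
noncomputable def forceL (l : List ℕ) (f : List ℕ → Bool) : Bool :=
  @List.rec ℕ (fun _ => (List ℕ → Bool) → Bool) (fun f => f [])
    (fun x _ ih f => @Nat.rec (fun _ => Bool) (ih fun xs => f (0 :: xs)) (fun k _ => ih fun xs => f (Nat.add k 1 :: xs)) x)
    l f

/-- Force a natural number, then continue. -/
noncomputable def forceN (n : ℕ) (f : ℕ → Bool) : Bool :=
  @Nat.rec (fun _ => Bool) (f 0) (fun k _ => f (Nat.add k 1)) n

/-- `l[i]` with default `0`. -/
noncomputable def getI (l : List ℕ) (i : ℕ) : ℕ :=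
  @List.rec ℕ (fun _ => ℕ → ℕ) (fun _ => 0) (fun x _ ih i => @Nat.rec (fun _ => ℕ) x (fun j _ => ih j) i) l i

/-- `l ++ [x]`. -/
noncomputable def snoc (l : List ℕ) (x : ℕ) : List ℕ :=
  @List.rec ℕ (fun _ => List ℕ) [x] (fun y _ ih => y :: ih) l

/-- `all i < n, p i`. -/
noncomputable def allN (n : ℕ) (p : ℕ → Bool) : Bool :=
  @Nat.rec (fun _ => Bool) true (fun i ih => ih && p i) n

/-- `any i < n, p i`. -/
noncomputable def anyN (n : ℕ) (p : ℕ → Bool) : Bool :=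
  @Nat.rec (fun _ => Bool) false (fun i ih => ih || p i) n

/-! ## Code arithmetic -/

/-- Code arithmetic of an encoded finite abelian group (instances and their correctness: soundness file): addition and
subtraction of codes, and the number of codes (`= |H|`, codes are `0 … nEl − 1`, the code of `0` is `0`). -/
structure CArith where
  /-- addition on codes -/ addC : ℕ → ℕ → ℕ
  /-- subtraction on codes -/ subC : ℕ → ℕ → ℕ
  /-- number of codes -/ nEl : ℕ

/-- `ZMod n` on `ZMod.val` codes. -/
def cyc (n : ℕ) : CArith := ⟨fun x y => (x + y) % n, fun x y => (x + (n - y)) % n, n⟩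

/-- `ZMod 3 × ZMod 3` on the codes `3 u + v`. -/
def z33 : CArith :=
  ⟨fun x y => 3 * ((x / 3 + y / 3) % 3) + (x % 3 + y % 3) % 3,
   fun x y => 3 * ((x / 3 + (3 - y / 3)) % 3) + (x % 3 + (3 - y % 3)) % 3, 9⟩

/-! ## Slot labels -/

/-- Relabel: every label equal to `a` becomes `b`. -/
noncomputable def relabel (L : List ℕ) (a b : ℕ) : List ℕ :=
  @List.rec ℕ (fun _ => List ℕ) [] (fun y _ ih => (@Bool.rec (fun _ => ℕ) y b (Nat.beq y a)) :: ih) L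

/-- Merge the slots `AB_i = 3i`, `BC_j = 3j+1`, `AC_k = 3k+2` (the three slots a zero triple `(i,j,k)` forces into one plane). -/
noncomputable def merge3 (L : List ℕ) (i j k : ℕ) : List ℕ :=
  let L1 := relabel L (getI L (3 * i)) (getI L (3 * j + 1))
  relabel L1 (getI L1 (3 * j + 1)) (getI L1 (3 * k + 2))

/-- Apply a list of merges one by one, forcing the label list after each (continuation-passing). -/
noncomputable def applyMerges (zs : List (ℕ × ℕ × ℕ)) (L : List ℕ) (k : List ℕ → Bool) : Bool :=
  @List.rec (ℕ × ℕ × ℕ) (fun _ => List ℕ → Bool) (fun L => k L)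
    (fun z _ ih L => forceL (merge3 L z.1 z.2.1 z.2.2) ih) zs L

/-- CLASH below `m1`: some triple `t < m1` has two of its three slots with the same label. -/
noncomputable def clash (L : List ℕ) (m1 : ℕ) : Bool :=
  anyN m1 fun t => Nat.beq (getI L (3*t)) (getI L (3*t+1)) || Nat.beq (getI L (3*t+1)) (getI L (3*t+2)) ||
    Nat.beq (getI L (3*t)) (getI L (3*t+2))

/-! ## Zero triples of a new index -/

/-- For one ordered pair `(i, j)` of old indices: the zero triples among `(m,i,j)`, `(i,m,j)`, `(i,j,m)` when index `m` gets
codes `(x, y)`; `bi ci bj cj` are the codes of `b_i c_i b_j c_j`.  Zero triple `(i',j',k')` ⟺ `b_{j'} + c_{k'} = b_{i'} + c_{j'}`. -/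
noncomputable def zerosOrd (A : CArith) (m x y i j bi ci bj cj : ℕ) (acc : List (ℕ × ℕ × ℕ)) : List (ℕ × ℕ × ℕ) :=
  let a1 := @Bool.rec (fun _ => List (ℕ × ℕ × ℕ)) acc ((m, i, j) :: acc) (Nat.beq (A.addC bi cj) (A.addC x ci))
  let a2 := @Bool.rec (fun _ => List (ℕ × ℕ × ℕ)) a1 ((i, m, j) :: a1) (Nat.beq (A.addC x cj) (A.addC bi y))
  @Bool.rec (fun _ => List (ℕ × ℕ × ℕ)) a2 ((i, j, m) :: a2) (Nat.beq (A.addC bj y) (A.addC bi cj))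

/-- All zero triples created by the new index `m` with codes `(x, y)` over the prefix code lists `B C` (length `m`). -/
noncomputable def zeros (A : CArith) (B C : List ℕ) (m x y : ℕ) : List (ℕ × ℕ × ℕ) :=
  @Nat.rec (fun _ => List (ℕ × ℕ × ℕ)) [] (fun i acc =>
    @Nat.rec (fun _ => List (ℕ × ℕ × ℕ)) acc (fun j acc =>
      zerosOrd A m x y j i (getI B j) (getI C j) (getI B i) (getI C i)
        (zerosOrd A m x y i j (getI B i) (getI C i) (getI B j) (getI C j) acc)) i) m

/-! ## The forbidden mask and the search -/

/-- Bit mask of the codes `y` forbidden for `c_m` when `b_m` has code `x`: the used `c_i` and the solutions of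
`b_m + c_i = b_i + c_m` (`y = x + c_i − b_i`), `i < m`. -/
noncomputable def forbMask (A : CArith) (B C : List ℕ) (m x : ℕ) : ℕ :=
  @Nat.rec (fun _ => ℕ) 0 (fun i acc =>
    Nat.lor (Nat.lor acc (Nat.shiftLeft 1 (getI C i))) (Nat.shiftLeft 1 (A.subC (A.addC x (getI C i)) (getI B i)))) m

/-- THE SEARCH.  `dfs A r m B C L`: prefix of `m ≥ 1` triples with code lists `B C` and (forced) slot labels `L`, `r` triples still
to place; returns `true` iff EVERY completion is pruned by a clash (a completed consistent assignment returns `false`). -/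
noncomputable def dfs (A : CArith) : ℕ → ℕ → List ℕ → List ℕ → List ℕ → Bool :=
  fun r => @Nat.rec (fun _ => ℕ → List ℕ → List ℕ → List ℕ → Bool) (fun _ _ _ _ => false)
    (fun _ rec m B C L =>
      allN A.nEl fun x => Nat.ble x (getI B (m - 1)) || forceN (forbMask A B C m x) fun fm => allN A.nEl fun y =>
        Nat.testBit fm y ||
          applyMerges (zeros A B C m x y) L fun L' =>
            clash L' (m + 1) || forceL (snoc B x) fun B' => forceL (snoc C y) fun C' => rec (m + 1) B' C' L')
    r

/-- The search for `K` triples from the root `b₀ = c₀ = 0`, identity labels on the `3K` slots. -/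
noncomputable def check (A : CArith) (K : ℕ) : Bool := dfs A (K - 1) 1 [0] [0] (List.range (3 * K))

/-- A CHUNK of the search: the subtree below the level-1 choice `(b₁, c₁) = (x, y)` (for splitting big kernel evaluations);
`true` also when `(x, y)` is not a child of the root at all. -/
noncomputable def checkFrom (A : CArith) (K x y : ℕ) : Bool :=
  Nat.ble x 0 || Nat.testBit (forbMask A [0] [0] 1 x) y ||
    applyMerges (zeros A [0] [0] 1 x y) (List.range (3 * K)) fun L' =>
      clash L' 2 || dfs A (K - 2) 2 [0, x] [0, y] L'

end IcosetH

end Summit.MatrixMultiplication.OmegaCensus
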